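import Summits.CriticalPhenomena.CardyFormulaZ2.Theorems.CardyBoundaryCoulombGasHalfPlaneMarkDensityLawSelfDualityTrap

/-!
# `HalfPlaneMarkDensityLaw` (crux stmt-CriticalPhenomena-5661), line `Sketch`, wave 2:
# stub `stub_dualSeal` — a moat-to-moat dual walk seals the boundary segment between its feet

The lattice half-plane is `H = ℤ × ℕ` (`halfPlane = {v | 0 ≤ v 1}`); the "moat" is the row of dual
faces `(x,-1)` just below the boundary row (`dualConfig`, faces indexed by lower-left corners).
A dual-open face walk `Q` from the moat face `(p₁,-1)` to the moat face `(p₂,-1)`, `p₁ < p₂`,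
through faces of height `≥ -1` and never running along the moat (every edge of `Q` has an endpoint
of height `≥ 0`) encloses the boundary vertices `(p₁+1,0), …, (p₂,0)`: no open path of `H` joins a
boundary vertex `u` with `u 0 ≤ p₁` to a boundary vertex `v` with `p₁ < v 0 ≤ p₂`.

Proof (the argument of `SelfDual.not_primal_and_dual'`): if `ω ∈ openConnIn halfPlane u v`, open
the two virtual legs `leg (u 0)`, `leg (v 0)` under the endpoints (paths of `H` never use legs, and
`Q` never crosses them: `SelfDual.mem_dualConfig_insert_legs`), take an open walk `P` of `H` from
`(u 0, 0)` to `(v 0, 0)` (`exists_walk_of_mem_openConnIn`), and apply the moat-endpoint trapping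
lemma `SelfDual.moat_end_trapped` with `a = u 0 ≤ b = p₁ < c = v 0`: the dual walk started at the
moat face `(p₁,-1)` must end strictly between the legs, `v 0 > p₂`, contradicting `v 0 ≤ p₂`.
-/

noncomputable section

namespace Summit.CriticalPhenomena.CardyFormulaZ2.Cruxes.HalfPlaneMarkDensityLaw.SketchLine

open Literature.Probability.Percolation Literature.Probability.LatticeModels
open MeasureTheory Filter Set SimpleGraph
open scoped Topology
open Summit.CriticalPhenomena.CardyFormulaZ2.Theorems.HalfPlaneMarkDensityLaw.Negative

namespace Window

/-- **Sealing by a moat-to-moat dual walk.**  A dual face walk from the moat face `(p₁,-1)` to the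
moat face `(p₂,-1)` (`p₁ < p₂`) with edges in `dualConfig ω`, through faces of height `≥ -1`, all of
whose edges have an endpoint of height `≥ 0`, separates inside `ℤ × ℕ` every boundary vertex `u`
with `u 0 ≤ p₁` from every boundary vertex `v` with `p₁ < v 0 ≤ p₂`: `ω ∉ {u ↔ v in halfPlane}`.
(Winding-number trapping `SelfDual.moat_end_trapped` after opening the two virtual legs under `u`
and `v`.) [folklore] -/
theorem stub_dualSeal :
    ∀ (ω : BondConfig (Site 2)), ω ⊆ (zdGraph 2).edgeSet → ∀ (p₁ p₂ : ℤ), p₁ < p₂ →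
      (∃ Q : (zdGraph 2).Walk (![p₁, -1] : Site 2) ![p₂, -1],
          (∀ e ∈ Q.edges, e ∈ dualConfig ω) ∧ (∀ z ∈ Q.support, -1 ≤ z 1) ∧
          (∀ e ∈ Q.edges, ∃ w ∈ e, (0 : ℤ) ≤ w 1)) →
      ∀ (u v : Site 2), u 1 = 0 → v 1 = 0 → u 0 ≤ p₁ → p₁ < v 0 → v 0 ≤ p₂ →
        ω ∉ openConnIn halfPlane u v := by
  intro ω hω p₁ p₂ _hp hQ u v hu hv hup hpv hvp hconn
  obtain ⟨Q, hQω, hQS, hQ0⟩ := hQ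
  -- the primal path of the half-plane from `u = (u 0, 0)` to `v = (v 0, 0)`
  obtain ⟨P₀, hP₀S, hP₀ω⟩ := exists_walk_of_mem_openConnIn hω hconn
  have hu' : u = ![u 0, 0] := by ext i; fin_cases i <;> simp [hu]
  have hv' : v = ![v 0, 0] := by ext i; fin_cases i <;> simp [hv]
  set ℓ := u 0 with hℓ
  set r := v 0 with hr
  set P : (zdGraph 2).Walk (![ℓ, 0] : Site 2) ![r, 0] := P₀.copy hu' hv' with hPdef
  have hPS : ∀ z ∈ P.support, 0 ≤ z 1 := by
    intro z hz
    rw [hPdef, Walk.support_copy] at hz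
    exact hP₀S z hz
  -- open the two virtual legs under the endpoints: the primal path stays open …
  have hPω : ∀ e ∈ P.edges, e ∈ insert (Z2HalfPlane.leg ℓ) (insert (Z2HalfPlane.leg r) ω) := by
    intro e he
    rw [hPdef, Walk.edges_copy] at he
    exact Set.mem_insert_of_mem _ (Set.mem_insert_of_mem _ (hP₀ω e he))
  -- … and the dual walk, which never runs along the moat, stays dual-open
  have hQω' : ∀ e ∈ Q.edges,
      e ∈ dualConfig (insert (Z2HalfPlane.leg ℓ) (insert (Z2HalfPlane.leg r) ω)) :=
    fun e he => SelfDual.mem_dualConfig_insert_legs (hQω e he) (hQ0 e he)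
  have hleg_ℓ : Z2HalfPlane.leg ℓ ∈ insert (Z2HalfPlane.leg ℓ) (insert (Z2HalfPlane.leg r) ω) :=
    Set.mem_insert _ _
  have hleg_r : Z2HalfPlane.leg r ∈ insert (Z2HalfPlane.leg ℓ) (insert (Z2HalfPlane.leg r) ω) :=
    Set.mem_insert_of_mem _ (Set.mem_insert _ _)
  -- trapping: the dual walk from the moat face `(p₁,-1)` ends strictly between the legs
  have htrap := SelfDual.moat_end_trapped
    (ω := insert (Z2HalfPlane.leg ℓ) (insert (Z2HalfPlane.leg r) ω)) (a := ℓ) (b := p₁) (c := r)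
    hup hpv hleg_ℓ hleg_r P hPω hPS Q hQω' hQS (by simp)
  simp only [Matrix.cons_val_zero] at htrap
  omega

end Window

end Summit.CriticalPhenomena.CardyFormulaZ2.Cruxes.HalfPlaneMarkDensityLaw.SketchLine
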